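import Literature.NumberTheory.EllipticCurves.ModularCurveEtaQuotientsProofs
import HarnessLib

/-!
# The level-`32` `η`-quotients `η(16τ)⁶/(η(8τ)²η(32τ)⁴)`, `η(8τ)¹⁰/(η(4τ)⁴η(16τ)²η(32τ)⁴)`,
# `η(8τ)⁴η(16τ)²/(η(4τ)²η(32τ)⁴)` are modular units on `X₀(32)` (Ligozat's criterion, instantiated)

Topic `Literature/NumberTheory/EllipticCurves`; namespace `Literature.NumberTheory.EllipticCurves.ModularForms`
(sequel of `ModularCurveEtaQuotientsProofs`). Cell `bsd-print-cf2` (typer seat `-ty2` g47), typer input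
**(U1)** of crux `stmt-BirchSwinnertonDyer-20509`, line `offtyz-v7` (LEAD memo
`Cruxes/RamifiedOffTYZOfFacts/Lines/offtyz_v7_RigidityAndUnits.md` §4(e), §4ter). THEOREMS ONLY
(three exponent vectors as `def`s with bodies; no named fact, no `sorry`, no instance):
Ligozat's criterion for an `η`-quotient `g_r = ∏_{δ∣N} η(δτ)^{r_δ}` to be a function on `X₀(N)` —
Ligozat 1975, Prop. 3.2.1: «(A) `Σ r_δ δ ≡ 0 (mod 24)`, (B) `Σ r_δ δ′ ≡ 0 (mod 24)` (`δ′ = N/δ`),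
(C) `Σ r_δ = 0`, (D′) `∏ δ′^{r_δ} ∈ ℚ²`» — is the tree's PROVED `etaQuotient_slash_of_mem_Gamma0` at
weight `k = 0` under `NewmanCond N r 0` (Newman 1959 / Savitt 2025 Thm. 1), and Ligozat's order of `g_r` at
the cusps of level `d` (Prop. 3.2.8) is the tree's `cuspOrder24` (exact exponential rate at every cusp:
`exists_norm_eta_natMul_SL2_smul_sq`, `isZeroAtImInfty_etaQuotient_slash`). This file INSTANTIATES
them at `N = 32` for the three exponent vectors of the memo §4ter,

  `x_η = η(16τ)⁶/(η(8τ)²η(32τ)⁴)`, `(x²+4)_η = η(8τ)¹⁰/(η(4τ)⁴η(16τ)²η(32τ)⁴)`,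
  `y_η = η(8τ)⁴η(16τ)²/(η(4τ)²η(32τ)⁴)`,

which the LEAD identified numerically (exact rational `q`-series to `O(q¹⁰⁰)`) with the coordinates
`x = ℘_Λ(u)`, `x² + 4`, `y = ℘′_Λ(u)/2` of `A ≅ (X₀(32), ∞)`, `A : y² = x³ + 4x` — the minimal
equation of `X₀(32)` printed by Ligozat, table (4.2.6) (`λ = μ = α = γ = 0`, `β = 4`) — under the
modular parametrisation by `f = η(4τ)²η(8τ)²` (Ligozat, table (3.1.2), `N = 32`):

* `newmanCond_rX`, `newmanCond_rXsq`, `newmanCond_rY` — Newman's/Ligozat's conditions hold in weight `0`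
  (decidable arithmetic: `Σ r_δ = 0`; `Σ δr_δ = −48, −96, −72`; `Σ (32/δ)r_δ = 0, 0, 0`;
  `∏ δ^{|r_δ|} = 2⁵⁰, 2⁶⁶, 2⁴⁴` squares);
* `etaQuotient_rX_slash` (etc.) — **`Γ₀(32)`-invariance in weight `0`**: `x_η ∣[0] γ = x_η` for every
  `γ ∈ Γ₀(32)`; `etaQuotient_rX_smul`: `x_η(γτ) = x_η(τ)`;
* `etaQuotient_rX_ne_zero` (etc.) — no zeros on `ℍ` (so the divisors are supported on the cusps:
  `x_η`, `(x²+4)_η`, `y_η` are MODULAR UNITS of level `32`);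
* `cuspOrder24_level32` — Ligozat's orders at the eight cusps of `X₀(32)` (cusp levels
  `d = 1, 2, 4, 8, 16, 32`; `φ(gcd(d, 32/d))` cusps of level `d`: `1, 1, 2, 2, 1, 1`), as the vector
  `(cuspOrder24 32 r d)_d` (`= 24·d·gcd(d, 32/d)·ord_d`, Prop. 3.2.8): for `x_η`: `(0, 0, 0, 0, 1536, −1536)`;
  for `(x²+4)_η`: `(0, 0, 0, 1536, 0, −3072)`; for `y_η`: `(0, 0, 0, 768, 768, −2304)` — i.e. `x_η` has a
  double pole at `∞` (`−1536/(24·32) = −2`, matching `q²x = 1 + 2q⁸ − …`) and a double zero at the ONE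
  (rational) cusp of level `16`; `(x²+4)_η` has a pole of order `4` at `∞` and double zeros at the TWO cusps
  of level `8` (conjugate over `ℚ(i)`); `y_η` has a pole of order `3` at `∞` and simple zeros at the cusps of
  levels `8` (two) and `16` (one) — consistent with `div(x) = 2(P₀) − 2(∞)`,
  `div(x² + 4) = 2(P_{2i}) + 2(P_{−2i}) − 4(∞)`, `div(y) = (P₀) + (P_{2i}) + (P_{−2i}) − 3(∞)` on `A` and
  «the cusps ARE `A[(1+i)³]`» (memo §4(a): `4` rational cusps `d = 1, 2, 16, 32`, `4` over `ℚ(i)` at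
  `d = 4, 8`); `tendsto_etaQuotient_level32`: the leading terms `q²·x_η → 1`, `q⁴·(x²+4)_η → 1`,
  `q³·y_η → 1` at `i∞`.

NOT proved here (prover work, census-verified by the LEAD): the IDENTITIES `x ∘ φ = x_η`, `y ∘ φ = ±y_η`
with the modular parametrisation `φ` (they need the divisor of `x ∘ φ`, i.e. the images of the cusps
under `φ`, and Liouville on `X₀(32)`); Ligozat does not print them (his coordinates for `N = 32` come
from Fricke's functions `σ, τ` of §4.1).

References: [Ligozat1975] G. Ligozat, *Courbes modulaires de genre 1*, Mém. SMF 43 (1975) — Prop. 3.2.1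
(memoir p. 31), Prop. 3.2.8 (p. 34), table (3.1.2) (`N = 32`: `η(4z)²η(8z)²`, p. 30), table (3.3.1)
(order of `P₁ − P₃₂` in `J₀(32)` is `4`, p. 40), table (4.2.6) (`X₀(32)`: `y² = x³ + 4x`, p. 45) (held
text `paper:doi-10-24033-msmf-178`); [Savitt2025] Thm. 1, Rem. 2; [Newman1959]; [KubertLang1981] Ch. 1–2
(modular units; not held).
-/

noncomputable section

open UpperHalfPlane hiding I
open ModularForm Complex Matrix.SpecialLinearGroup Filter CongruenceSubgroup
open scoped MatrixGroups Real ModularForm CongruenceSubgroup Topology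

namespace Literature.NumberTheory.EllipticCurves.ModularForms

/-! ## The three exponent vectors -/

/-- Exponents of `x_η = η(16τ)⁶ η(8τ)⁻² η(32τ)⁻⁴`. [cite: Ligozat1975, Prop. 3.2.1 (the family r = (r_δ)_{δ∣N})] -/
def rX : ℕ → ℤ := fun δ => if δ = 16 then 6 else if δ = 8 then -2 else if δ = 32 then -4 else 0

/-- Exponents of `(x²+4)_η = η(8τ)¹⁰ η(4τ)⁻⁴ η(16τ)⁻² η(32τ)⁻⁴`. [cite: Ligozat1975, Prop. 3.2.1] -/
def rXsq : ℕ → ℤ :=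
  fun δ => if δ = 8 then 10 else if δ = 4 then -4 else if δ = 16 then -2 else if δ = 32 then -4 else 0

/-- Exponents of `y_η = η(8τ)⁴ η(16τ)² η(4τ)⁻² η(32τ)⁻⁴`. [cite: Ligozat1975, Prop. 3.2.1] -/
def rY : ℕ → ℤ :=
  fun δ => if δ = 8 then 4 else if δ = 16 then 2 else if δ = 4 then -2 else if δ = 32 then -4 else 0

/-! ## Ligozat's conditions (A), (B), (C), (D′) at `N = 32`, weight `0` -/

/-- `x_η` satisfies Newman's/Ligozat's conditions in weight `0`: `Σ r_δ = 0`, `Σ δ r_δ = −48`,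
`Σ (32/δ) r_δ = 0`, `∏ δ^{|r_δ|} = 2⁵⁰ = (2²⁵)²`. [cite: Ligozat1975, Prop. 3.2.1 (conditions (A), (B), (C), (D′))] [cite: Savitt2025, Thm. 1] -/
theorem newmanCond_rX : NewmanCond 32 rX 0 := by
  refine ⟨by decide, by decide, by decide, ⟨2 ^ 25, by decide⟩⟩

/-- `(x²+4)_η` satisfies the conditions in weight `0`: `Σ r_δ = 0`, `Σ δ r_δ = −96`, `Σ (32/δ) r_δ = 0`,
`∏ δ^{|r_δ|} = 2⁶⁶ = (2³³)²`. [cite: Ligozat1975, Prop. 3.2.1] [cite: Savitt2025, Thm. 1] -/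
theorem newmanCond_rXsq : NewmanCond 32 rXsq 0 := by
  refine ⟨by decide, by decide, by decide, ⟨2 ^ 33, by decide⟩⟩

/-- `y_η` satisfies the conditions in weight `0`: `Σ r_δ = 0`, `Σ δ r_δ = −72`, `Σ (32/δ) r_δ = 0`,
`∏ δ^{|r_δ|} = 2⁴⁴ = (2²²)²`. [cite: Ligozat1975, Prop. 3.2.1] [cite: Savitt2025, Thm. 1] -/
theorem newmanCond_rY : NewmanCond 32 rY 0 := by
  refine ⟨by decide, by decide, by decide, ⟨2 ^ 22, by decide⟩⟩

/-! ## `Γ₀(32)`-invariance, non-vanishing, leading terms -/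

/-- **`x_η` is a function on `X₀(32)`**: `x_η ∣[0] γ = x_η` for `γ ∈ Γ₀(32)`. [cite: Ligozat1975, Prop. 3.2.1 (sufficiency)] [cite: Savitt2025, Thm. 1] -/
theorem etaQuotient_rX_slash {γ : SL(2, ℤ)} (hγ : γ ∈ Gamma0 32) :
    etaQuotient 32 rX ∣[(0 : ℤ)] γ = etaQuotient 32 rX :=
  etaQuotient_slash_of_mem_Gamma0 32 (by norm_num) rX 0 ⟨0, rfl⟩ newmanCond_rX hγ

/-- `(x²+4)_η ∣[0] γ = (x²+4)_η` for `γ ∈ Γ₀(32)`. [cite: Ligozat1975, Prop. 3.2.1 (sufficiency)] [cite: Savitt2025, Thm. 1] -/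
theorem etaQuotient_rXsq_slash {γ : SL(2, ℤ)} (hγ : γ ∈ Gamma0 32) :
    etaQuotient 32 rXsq ∣[(0 : ℤ)] γ = etaQuotient 32 rXsq :=
  etaQuotient_slash_of_mem_Gamma0 32 (by norm_num) rXsq 0 ⟨0, rfl⟩ newmanCond_rXsq hγ

/-- `y_η ∣[0] γ = y_η` for `γ ∈ Γ₀(32)`. [cite: Ligozat1975, Prop. 3.2.1 (sufficiency)] [cite: Savitt2025, Thm. 1] -/
theorem etaQuotient_rY_slash {γ : SL(2, ℤ)} (hγ : γ ∈ Gamma0 32) :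
    etaQuotient 32 rY ∣[(0 : ℤ)] γ = etaQuotient 32 rY :=
  etaQuotient_slash_of_mem_Gamma0 32 (by norm_num) rY 0 ⟨0, rfl⟩ newmanCond_rY hγ

/-- Pointwise invariance: `x_η(γτ) = x_η(τ)`, `(x²+4)_η(γτ) = (x²+4)_η(τ)`, `y_η(γτ) = y_η(τ)` for
`γ ∈ Γ₀(32)`. [cite: Ligozat1975, Prop. 3.2.1 (sufficiency)] [cite: Savitt2025, Thm. 1] -/
theorem etaQuotient_level32_smul {γ : SL(2, ℤ)} (hγ : γ ∈ Gamma0 32) (τ : ℍ) :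
    etaQuotient 32 rX (γ • τ) = etaQuotient 32 rX τ ∧
      etaQuotient 32 rXsq (γ • τ) = etaQuotient 32 rXsq τ ∧
        etaQuotient 32 rY (γ • τ) = etaQuotient 32 rY τ := by
  refine ⟨?_, ?_, ?_⟩
  · simpa using etaQuotient_smul_of_mem_Gamma0 32 (by norm_num) rX 0 ⟨0, rfl⟩ newmanCond_rX hγ τ
  · simpa using etaQuotient_smul_of_mem_Gamma0 32 (by norm_num) rXsq 0 ⟨0, rfl⟩ newmanCond_rXsq hγ τ
  · simpa using etaQuotient_smul_of_mem_Gamma0 32 (by norm_num) rY 0 ⟨0, rfl⟩ newmanCond_rY hγ τ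

/-- **No zeros on `ℍ`** (the divisors of the three functions on `X₀(32)` are supported on the cusps:
they are modular UNITS). [cite: Ligozat1975, Prop. 3.2.8 (the divisor of g_r is cuspidal)] -/
theorem etaQuotient_level32_ne_zero (τ : ℍ) :
    etaQuotient 32 rX τ ≠ 0 ∧ etaQuotient 32 rXsq τ ≠ 0 ∧ etaQuotient 32 rY τ ≠ 0 :=
  ⟨etaQuotient_ne_zero 32 rX τ, etaQuotient_ne_zero 32 rXsq τ, etaQuotient_ne_zero 32 rY τ⟩

/-- **Leading terms at `i∞`**: `x_η / q⁻² → 1`, `(x²+4)_η / q⁻⁴ → 1`, `y_η / q⁻³ → 1` (`q = e^{2πiτ}`):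
poles of orders `2, 4, 3` at the cusp `∞`, leading coefficient `1` (as for `x = ℘(u)`, `x² + 4`,
`y = ℘′(u)/2` along `u = q + …`). [cite: Ligozat1975, Prop. 3.2.8 (order at the cusp ∞ = Σ δ r_δ / 24)] -/
theorem tendsto_etaQuotient_level32 :
    Tendsto (fun τ : ℍ ↦ etaQuotient 32 rX τ / Function.Periodic.qParam 1 τ ^ (-2 : ℤ)) atImInfty (𝓝 1) ∧
      Tendsto (fun τ : ℍ ↦ etaQuotient 32 rXsq τ / Function.Periodic.qParam 1 τ ^ (-4 : ℤ)) atImInfty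
        (𝓝 1) ∧
      Tendsto (fun τ : ℍ ↦ etaQuotient 32 rY τ / Function.Periodic.qParam 1 τ ^ (-3 : ℤ)) atImInfty
        (𝓝 1) :=
  ⟨tendsto_etaQuotient_div_qParam_zpow 32 rX (-2) (by decide),
    tendsto_etaQuotient_div_qParam_zpow 32 rXsq (-4) (by decide),
    tendsto_etaQuotient_div_qParam_zpow 32 rY (-3) (by decide)⟩

/-! ## Ligozat's orders at the cusps of `X₀(32)` -/

/-- **Orders at the cusps** (Ligozat's valuation `v_d(g_r)` at a cusp of level `d`, times
`24·d·gcd(d, N/d)`, is the tree's `cuspOrder24 N r d = Σ_δ r_δ gcd(δ, d)² (N/δ)`), at the cusp levels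
`d ∣ 32`: `x_η ↦ (0, 0, 0, 0, 1536, −1536)`, `(x²+4)_η ↦ (0, 0, 0, 1536, 0, −3072)`,
`y_η ↦ (0, 0, 0, 768, 768, −2304)` for `d = 1, 2, 4, 8, 16, 32` — `x_η` vanishes exactly at the cusp of
level `16` (double zero), `(x²+4)_η` at the two cusps of level `8` (double zeros), `y_η` at the cusps of
levels `8` and `16` (simple zeros); all three have their only pole at `∞` (`d = 32`; orders `2, 4, 3`).
[cite: Ligozat1975, Prop. 3.2.8 (valuation of g_r at a cusp of level d)] [cite: Savitt2025, Rem. 2] -/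
theorem cuspOrder24_level32 :
    (cuspOrder24 32 rX 1 = 0 ∧ cuspOrder24 32 rX 2 = 0 ∧ cuspOrder24 32 rX 4 = 0 ∧
      cuspOrder24 32 rX 8 = 0 ∧ cuspOrder24 32 rX 16 = 1536 ∧ cuspOrder24 32 rX 32 = -1536) ∧
    (cuspOrder24 32 rXsq 1 = 0 ∧ cuspOrder24 32 rXsq 2 = 0 ∧ cuspOrder24 32 rXsq 4 = 0 ∧
      cuspOrder24 32 rXsq 8 = 1536 ∧ cuspOrder24 32 rXsq 16 = 0 ∧ cuspOrder24 32 rXsq 32 = -3072) ∧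
    (cuspOrder24 32 rY 1 = 0 ∧ cuspOrder24 32 rY 2 = 0 ∧ cuspOrder24 32 rY 4 = 0 ∧
      cuspOrder24 32 rY 8 = 768 ∧ cuspOrder24 32 rY 16 = 768 ∧ cuspOrder24 32 rY 32 = -2304) := by
  refine ⟨⟨?_, ?_, ?_, ?_, ?_, ?_⟩, ⟨?_, ?_, ?_, ?_, ?_, ?_⟩, ⟨?_, ?_, ?_, ?_, ?_, ?_⟩⟩ <;> decide

/-- **Vanishing at the cusps of positive order**: `x_η ∣[0] γ → 0` at `i∞` for every `γ ∈ SL₂(ℤ)`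
whose lower-left entry `c` has `gcd(32, c) = 16` (the cusp `1/16` of level `16`); likewise (not spelled
out) for `(x²+4)_η` at level `8` and `y_η` at levels `8` and `16`. [cite: Ligozat1975, Prop. 3.2.8] [cite: Savitt2025, Rem. 2] -/
theorem isZeroAtImInfty_etaQuotient_rX_slash (γ : SL(2, ℤ)) (hγ : Nat.gcd 32 (γ 1 0).natAbs = 16) :
    IsZeroAtImInfty (etaQuotient 32 rX ∣[(0 : ℤ)] (γ : GL (Fin 2) ℝ)) := by
  refine isZeroAtImInfty_etaQuotient_slash 32 (by norm_num) rX 0 (by decide) γ ?_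
  rw [cuspOrder24_eq_gcd, hγ]
  decide

end Literature.NumberTheory.EllipticCurves.ModularForms

end
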